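import Summits.KontsevichZagierPeriods.KontsevichZagierPeriods.Theorems.SoloInformedAlgDenCalculus
import HarnessLib

/-!
# The DEN-calculus over a field of real algebraic numbers: RULE DIAG

Solo programme `solo-KontsevichZagierPeriods-informed`, session s107: the re-base of the
DEN-calculus of the cube crux on a coefficient field `K` of real algebraic numbers, step 7 —
the blow-up of the origin of the unit square read in the two triangle charts
`μ_low(v) = (v₀, v₀v₁)` and `μ_up(u) = (u₀u₁, u₁)` (`SoloInformedToricTriCharts`), for
`P, Q ∈ K[x₀, x₁]`.

* `soloInformed_presentable_of_diagonalChartsK` — `[σ, P/Q]` (`(0,1)² ⊆ σ ⊆ [0,1]²`) is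
  presentable as soon as the two pulled-back forms are `Pᵢ/Qᵢ` (`Pᵢ, Qᵢ ∈ K[v]`, `Qᵢ ≠ 0` on the
  open square) with every `[(0,1)², Pᵢ/Qᵢ]` presentable;
* `soloInformedDiagLowerK Q = Q(v₀, v₀v₁)/v₀`, `soloInformedDiagUpperK Q = Q(u₀u₁, u₁)/u₁`
  (`Q(0,0) = 0`), and **RULE DIAG over `K`** `soloInformed_presentableDenK_of_diag`: if `Q(0,0) = 0`,
  `Q ≠ 0` on the open square and both chart denominators are presentable denominators, then so
  is `Q`.

References: M. Kontsevich, D. Zagier, *Periods* (2001) §1.2 rules (1)–(2); W. Fulton,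
*Introduction to Toric Varieties* (1993) §2.6.
-/

noncomputable section

open scoped BigOperators
open MeasureTheory Set
open Literature.NumberTheory.Transcendental Literature.NumberTheory.Transcendental.KZ
open Literature.ModelTheory.ExponentialFields (IsSemialgebraic)
open Literature.AlgebraicGeometry.Resolution

namespace Summit.KontsevichZagierPeriods.KontsevichZagierPeriods.Theorems

variable {K : Type*} [Field K] [Algebra K ℝ]

/-! ## Presentability through the two triangle charts -/

/-- **Presentability through the diagonal charts**, `K`-coefficients.  Let `r = [σ, f]` with
`(0,1)² ⊆ σ ⊆ [0,1]²` and `f = P/Q` on the open square, and suppose the pulled-back forms along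
the lower and upper triangle charts are `P₁/Q₁` and `P₂/Q₂` (`Qᵢ ≠ 0` on the open square).  If
every `IntegralRep` on `(0,1)²` with integrand `Pᵢ/Qᵢ` is presentable (`i = 1, 2`), then `of r` is
presentable: split `σ` along the diagonal (rule (1a)) and apply rule (2) along the two charts.
[this work] -/
theorem soloInformed_presentable_of_diagonalChartsK
    (hK : ∀ c : K, IsAlgebraic ℚ (algebraMap K ℝ c)) (P Q P₁ Q₁ P₂ Q₂ : MvPolynomial (Fin 2) K)
    (hQ₁ : ∀ v ∈ soloInformedOpenCube 2, (MvPolynomial.aeval v Q₁ : ℝ) ≠ 0)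
    (hQ₂ : ∀ v ∈ soloInformedOpenCube 2, (MvPolynomial.aeval v Q₂ : ℝ) ≠ 0)
    (h₁ : ∀ v ∈ soloInformedOpenCube 2,
      (MvPolynomial.aeval (fun i => ∏ j, v j ^ soloInformedLowerMat i j) P : ℝ) /
          MvPolynomial.aeval (fun i => ∏ j, v j ^ soloInformedLowerMat i j) Q * v 0 =
        (MvPolynomial.aeval v P₁ : ℝ) / MvPolynomial.aeval v Q₁)
    (h₂ : ∀ v ∈ soloInformedOpenCube 2,
      (MvPolynomial.aeval (fun i => ∏ j, v j ^ soloInformedUpperMat i j) P : ℝ) /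
          MvPolynomial.aeval (fun i => ∏ j, v j ^ soloInformedUpperMat i j) Q * v 1 =
        (MvPolynomial.aeval v P₂ : ℝ) / MvPolynomial.aeval v Q₂)
    (hp₁ : ∀ ρ : IntegralRep 2, ρ.domain = soloInformedOpenCube 2 →
      EqOn ρ.integrand (fun v => (MvPolynomial.aeval v P₁ : ℝ) / MvPolynomial.aeval v Q₁)
        (soloInformedOpenCube 2) → of ρ ∈ soloInformedPresentable)
    (hp₂ : ∀ ρ : IntegralRep 2, ρ.domain = soloInformedOpenCube 2 →
      EqOn ρ.integrand (fun v => (MvPolynomial.aeval v P₂ : ℝ) / MvPolynomial.aeval v Q₂)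
        (soloInformedOpenCube 2) → of ρ ∈ soloInformedPresentable)
    (r : IntegralRep 2) (hO : soloInformedOpenCube 2 ⊆ r.domain)
    (hC : r.domain ⊆ soloInformedCube 2)
    (hri : EqOn r.integrand (fun x => (MvPolynomial.aeval x P : ℝ) / MvPolynomial.aeval x Q)
      (soloInformedOpenCube 2)) :
    of r ∈ soloInformedPresentable := by
  have hT₁ : soloInformedLowerTri ⊆ r.domain := soloInformedLowerTri_subset_openCube.trans hO
  have hT₂ : soloInformedUpperTri ⊆ r.domain := soloInformedUpperTri_subset_openCube.trans hO
  refine soloInformed_presentable_of_cover r isSemialgebraic_soloInformedLowerTri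
    isSemialgebraic_soloInformedUpperTri hT₁ hT₂
    (by rw [soloInformedLowerTri_inter_upperTri]; exact measure_empty)
    (measure_mono_null (show r.domain \ (soloInformedLowerTri ∪ soloInformedUpperTri) ⊆
        soloInformedCube 2 \ (soloInformedLowerTri ∪ soloInformedUpperTri) from
      fun _ hp => ⟨hC hp.1, hp.2⟩) soloInformed_volume_cube_diff_tris) ?_ ?_
  · refine soloInformed_presentable_of_monoChartK hK soloInformedLowerMat
      (by rw [soloInformed_det_lowerMat]; exact one_ne_zero) P₁ Q₁ hQ₁ _
      (by rw [IntegralRep.domain_restrict, soloInformed_image_lowerChart]) (fun v hv => ?_) hp₁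
    have hmem : (fun i => ∏ j, v j ^ soloInformedLowerMat i j) ∈ soloInformedOpenCube 2 :=
      soloInformedLowerTri_subset_openCube (soloInformed_image_lowerChart ▸ mem_image_of_mem _ hv)
    rw [IntegralRep.integrand_restrict, hri hmem,
      soloInformed_abs_det_monoD_lowerMat fun j => (hv j).1]
    exact h₁ v hv
  · refine soloInformed_presentable_of_monoChartK hK soloInformedUpperMat
      (by rw [soloInformed_det_upperMat]; exact one_ne_zero) P₂ Q₂ hQ₂ _
      (by rw [IntegralRep.domain_restrict, soloInformed_image_upperChart]) (fun v hv => ?_) hp₂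
    have hmem : (fun i => ∏ j, v j ^ soloInformedUpperMat i j) ∈ soloInformedOpenCube 2 :=
      soloInformedUpperTri_subset_openCube (soloInformed_image_upperChart ▸ mem_image_of_mem _ hv)
    rw [IntegralRep.integrand_restrict, hri hmem,
      soloInformed_abs_det_monoD_upperMat fun j => (hv j).1]
    exact h₂ v hv

/-! ## The chart denominators and RULE DIAG -/

/-- The lower chart denominator `Q_low = Q(v₀, v₀v₁) / v₀`, `Q ∈ K[x₀, x₁]`. -/
def soloInformedDiagLowerK (Q : MvPolynomial (Fin 2) K) : MvPolynomial (Fin 2) K :=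
  soloInformedChartQuotK soloInformedLowerMat Q ![1, 0]

/-- The upper chart denominator `Q_up = Q(u₀u₁, u₁) / u₁`, `Q ∈ K[x₀, x₁]`. -/
def soloInformedDiagUpperK (Q : MvPolynomial (Fin 2) K) : MvPolynomial (Fin 2) K :=
  soloInformedChartQuotK soloInformedUpperMat Q ![0, 1]

omit [Algebra K ℝ] in
/-- A polynomial without constant term has only exponents of positive total degree. -/
theorem soloInformed_one_le_of_mem_supportK {Q : MvPolynomial (Fin 2) K}
    (hQ0 : MvPolynomial.coeff 0 Q = 0) {a : Fin 2 →₀ ℕ} (ha : a ∈ Q.support) :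
    1 ≤ a 0 + a 1 := by
  rcases Nat.eq_zero_or_pos (a 0 + a 1) with h | h
  · exfalso
    have ha0 : a = 0 := by
      ext i
      fin_cases i <;> simp <;> omega
    rw [ha0] at ha
    exact (MvPolynomial.mem_support_iff.1 ha) hQ0
  · exact h

/-- `Q(v₀, v₀v₁) = v₀ · Q_low(v)` when `Q(0,0) = 0`. [this work] -/
theorem soloInformed_aeval_lowerChart_eq_mul_diagLowerK (Q : MvPolynomial (Fin 2) K)
    (hQ0 : MvPolynomial.coeff 0 Q = 0) (v : Fin 2 → ℝ) :
    (MvPolynomial.aeval (fun i => ∏ j, v j ^ soloInformedLowerMat i j) Q : ℝ) =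
      v 0 * MvPolynomial.aeval v (soloInformedDiagLowerK Q) := by
  have h := soloInformed_aevalK_monomialMap_eq soloInformedLowerMat Q ![1, 0] (fun a ha j => by
    fin_cases j
    · simpa [soloInformedLowerMat, Fin.sum_univ_two] using
        soloInformed_one_le_of_mem_supportK hQ0 ha
    · simp) v
  rw [h, soloInformedDiagLowerK, Fin.prod_univ_two]
  simp

/-- `Q(u₀u₁, u₁) = u₁ · Q_up(u)` when `Q(0,0) = 0`. [this work] -/
theorem soloInformed_aeval_upperChart_eq_mul_diagUpperK (Q : MvPolynomial (Fin 2) K)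
    (hQ0 : MvPolynomial.coeff 0 Q = 0) (v : Fin 2 → ℝ) :
    (MvPolynomial.aeval (fun i => ∏ j, v j ^ soloInformedUpperMat i j) Q : ℝ) =
      v 1 * MvPolynomial.aeval v (soloInformedDiagUpperK Q) := by
  have h := soloInformed_aevalK_monomialMap_eq soloInformedUpperMat Q ![0, 1] (fun a ha j => by
    fin_cases j
    · simp
    · simpa [soloInformedUpperMat, Fin.sum_univ_two] using
        soloInformed_one_le_of_mem_supportK hQ0 ha) v
  rw [h, soloInformedDiagUpperK, Fin.prod_univ_two]
  simp

/-- `Q_low ≠ 0` on the open square if `Q ≠ 0` there. [this work] -/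
theorem soloInformed_aeval_diagLowerK_ne_zero (Q : MvPolynomial (Fin 2) K)
    (hQ0 : MvPolynomial.coeff 0 Q = 0)
    (hQ : ∀ x ∈ soloInformedOpenCube 2, (MvPolynomial.aeval x Q : ℝ) ≠ 0) (v : Fin 2 → ℝ)
    (hv : v ∈ soloInformedOpenCube 2) :
    (MvPolynomial.aeval v (soloInformedDiagLowerK Q) : ℝ) ≠ 0 := by
  intro h0
  have hmem : (fun i => ∏ j, v j ^ soloInformedLowerMat i j) ∈ soloInformedOpenCube 2 :=
    soloInformedLowerTri_subset_openCube (soloInformed_image_lowerChart ▸ mem_image_of_mem _ hv)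
  exact hQ _ hmem (by rw [soloInformed_aeval_lowerChart_eq_mul_diagLowerK Q hQ0 v, h0, mul_zero])

/-- `Q_up ≠ 0` on the open square if `Q ≠ 0` there. [this work] -/
theorem soloInformed_aeval_diagUpperK_ne_zero (Q : MvPolynomial (Fin 2) K)
    (hQ0 : MvPolynomial.coeff 0 Q = 0)
    (hQ : ∀ x ∈ soloInformedOpenCube 2, (MvPolynomial.aeval x Q : ℝ) ≠ 0) (v : Fin 2 → ℝ)
    (hv : v ∈ soloInformedOpenCube 2) :
    (MvPolynomial.aeval v (soloInformedDiagUpperK Q) : ℝ) ≠ 0 := by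
  intro h0
  have hmem : (fun i => ∏ j, v j ^ soloInformedUpperMat i j) ∈ soloInformedOpenCube 2 :=
    soloInformedUpperTri_subset_openCube (soloInformed_image_upperChart ▸ mem_image_of_mem _ hv)
  exact hQ _ hmem (by rw [soloInformed_aeval_upperChart_eq_mul_diagUpperK Q hQ0 v, h0, mul_zero])

/-- The pulled-back form along the lower chart: `f(v₀, v₀v₁) v₀ = P_low(v)/Q_low(v)`.
[this work] -/
theorem soloInformed_diagK_lowerChart_form (P Q : MvPolynomial (Fin 2) K)
    (hQ0 : MvPolynomial.coeff 0 Q = 0)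
    (hQ : ∀ x ∈ soloInformedOpenCube 2, (MvPolynomial.aeval x Q : ℝ) ≠ 0) (v : Fin 2 → ℝ)
    (hv : v ∈ soloInformedOpenCube 2) :
    (MvPolynomial.aeval (fun i => ∏ j, v j ^ soloInformedLowerMat i j) P : ℝ) /
        MvPolynomial.aeval (fun i => ∏ j, v j ^ soloInformedLowerMat i j) Q * v 0 =
      (MvPolynomial.aeval v (soloInformedChartQuotK soloInformedLowerMat P 0) : ℝ) /
        MvPolynomial.aeval v (soloInformedDiagLowerK Q) := by
  rw [soloInformed_aeval_lowerChart_eq_mul_diagLowerK Q hQ0 v,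
    soloInformed_aeval_monomialMap_chartQuotK_zero soloInformedLowerMat P v]
  have h0 : v 0 ≠ 0 := (hv 0).1.ne'
  have hq := soloInformed_aeval_diagLowerK_ne_zero Q hQ0 hQ v hv
  field_simp

/-- The pulled-back form along the upper chart: `f(u₀u₁, u₁) u₁ = P_up(u)/Q_up(u)`.
[this work] -/
theorem soloInformed_diagK_upperChart_form (P Q : MvPolynomial (Fin 2) K)
    (hQ0 : MvPolynomial.coeff 0 Q = 0)
    (hQ : ∀ x ∈ soloInformedOpenCube 2, (MvPolynomial.aeval x Q : ℝ) ≠ 0) (v : Fin 2 → ℝ)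
    (hv : v ∈ soloInformedOpenCube 2) :
    (MvPolynomial.aeval (fun i => ∏ j, v j ^ soloInformedUpperMat i j) P : ℝ) /
        MvPolynomial.aeval (fun i => ∏ j, v j ^ soloInformedUpperMat i j) Q * v 1 =
      (MvPolynomial.aeval v (soloInformedChartQuotK soloInformedUpperMat P 0) : ℝ) /
        MvPolynomial.aeval v (soloInformedDiagUpperK Q) := by
  rw [soloInformed_aeval_upperChart_eq_mul_diagUpperK Q hQ0 v,
    soloInformed_aeval_monomialMap_chartQuotK_zero soloInformedUpperMat P v]
  have h0 : v 1 ≠ 0 := (hv 1).1.ne'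
  have hq := soloInformed_aeval_diagUpperK_ne_zero Q hQ0 hQ v hv
  field_simp

/-- **RULE DIAG over `K`.**  Let `Q ∈ K[x₀, x₁]` with `Q(0,0) = 0` and without zero on the open
square.  If the two chart denominators `Q_low = Q(v₀, v₀v₁)/v₀` and `Q_up = Q(u₀u₁, u₁)/u₁` are
presentable denominators, then so is `Q` (THEOREM DIAG: split along the diagonal, rule (2) along
the two triangle charts). [this work] -/
theorem soloInformed_presentableDenK_of_diag
    (hK : ∀ c : K, IsAlgebraic ℚ (algebraMap K ℝ c)) (Q : MvPolynomial (Fin 2) K)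
    (hQ0 : MvPolynomial.coeff 0 Q = 0)
    (hQ : ∀ x ∈ soloInformedOpenCube 2, (MvPolynomial.aeval x Q : ℝ) ≠ 0)
    (h₁ : SoloInformedPresentableDenK (soloInformedDiagLowerK Q))
    (h₂ : SoloInformedPresentableDenK (soloInformedDiagUpperK Q)) :
    SoloInformedPresentableDenK Q := fun P r hO hC hri =>
  soloInformed_presentable_of_diagonalChartsK hK P Q
    (soloInformedChartQuotK soloInformedLowerMat P 0) (soloInformedDiagLowerK Q)
    (soloInformedChartQuotK soloInformedUpperMat P 0) (soloInformedDiagUpperK Q)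
    (soloInformed_aeval_diagLowerK_ne_zero Q hQ0 hQ)
    (soloInformed_aeval_diagUpperK_ne_zero Q hQ0 hQ)
    (soloInformed_diagK_lowerChart_form P Q hQ0 hQ) (soloInformed_diagK_upperChart_form P Q hQ0 hQ)
    (fun ρ hρ hρi => h₁ _ ρ (by rw [hρ]) (by rw [hρ]; exact soloInformedOpenCube_subset_cube 2) hρi)
    (fun ρ hρ hρi => h₂ _ ρ (by rw [hρ]) (by rw [hρ]; exact soloInformedOpenCube_subset_cube 2) hρi)
    r hO hC hri

end Summit.KontsevichZagierPeriods.KontsevichZagierPeriods.Theorems
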